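import Literature.ComputerArithmetic.FloatingPoint.Formats
import Summits.Ventures.CertifiedArithmetic.LowPrec.Round

/-!
# Rounding errors of products and sums of minifloat data; exhaustive-table vocabulary

HONEST FRAMING (venture CertifiedArithmetic / cell `pub-lowprec`): certified error envelopes and
provably optimal rounding/accumulation schemes for low-precision formats under stated cost models;
every table by two implementations; no hardware or vendor claims.

For finite data `a b : MiniFloat φ` the exact product/sum is a rational and `fl` is `roundNE φ`
(round-to-nearest-even, saturating); `errMul`/`errAdd` are the signed errors `fl(a ∘ b) - (a ∘ b)`.
This file fixes that vocabulary, the datum-level operations `fmul`/`fadd` (= `roundNE` plus the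
IEEE 754 §6.3 sign of exact-zero results, heterogeneous operand formats, any destination format),
the row format of the exhaustive tables (`mulRow`/`addRow`, one row per ordered pair, enumerated by
`MiniFloat.all`), and proves the generic envelopes every table
must sit inside: the standard model `|err| ≤ max (u·|a∘b|) (quantum/2)` within range
[Higham2002ASNA, Thm 2.2, (2.4)–(2.5)], and exactness of sums that land in the unit-spacing region
(`errAdd = 0` when `|a + b| < 2^(m+1)·quantum`: sums of data are multiples of the quantum, and
small multiples are representable — the gradual-underflow exactness of addition [Higham2002ASNA,
§2.6, Problem 2.19; Hauser 1996]). The per-format numerical envelopes (maxima per binade) are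
kernel-evaluated from these definitions in the venture's table files, and exported as JSON to be
diffed against an independent implementation.
-/

namespace Literature.ComputerArithmetic.FloatingPoint

namespace MiniFloat

open Format

variable {φ : Format}

/-- Signed rounding error of the product: `fl(a·b) - a·b`, `fl = roundNE φ`. [folklore] -/
def errMul (φ : Format) (a b : MiniFloat φ) : ℚ :=
  (roundNE φ (a.toRat * b.toRat)).toRat - a.toRat * b.toRat

/-- Signed rounding error of the sum: `fl(a+b) - (a+b)`, `fl = roundNE φ`. [folklore] -/
def errAdd (φ : Format) (a b : MiniFloat φ) : ℚ :=
  (roundNE φ (a.toRat + b.toRat)).toRat - (a.toRat + b.toRat)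

/-- The signed zero of `ψ` with sign bit `neg`. [cite: IEEE7542019, §3.4] -/
def signedZero (ψ : Format) (neg : Bool) : MiniFloat ψ :=
  ⟨neg, 0, 0, Nat.zero_le _, Nat.two_pow_pos _, fun _ => Nat.zero_le _⟩

/-- `signedZero` has value `0`. [folklore] -/
@[simp] theorem toRat_signedZero (ψ : Format) (neg : Bool) : (signedZero ψ neg).toRat = 0 := by
  cases neg <;> simp [signedZero, toRat, toInt, scaledMag]

/-- IEEE multiplication of data of formats `φ₁`, `φ₂` delivered in format `ψ` under
roundTiesToEven with saturation: `roundNE ψ (a·b)`, except that an exact-zero product carries the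
XOR of the operand signs (IEEE 754 §6.3; `roundNE` alone would give `+0`). This is the DATUM-level
operation whose code tables are exported; its value is that of `roundNE`. [cite: IEEE7542019, §6.3] -/
def fmul {φ₁ φ₂ : Format} (ψ : Format) (a : MiniFloat φ₁) (b : MiniFloat φ₂) : MiniFloat ψ :=
  if a.toRat * b.toRat = 0 then signedZero ψ (a.neg != b.neg) else roundNE ψ (a.toRat * b.toRat)

/-- IEEE addition delivered in format `ψ` under roundTiesToEven with saturation: `roundNE ψ (a+b)`,
except that an exact-zero sum is `-0` iff both operands are negative (i.e. both are `-0`), else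
`+0` (IEEE 754 §6.3 for roundTiesToEven). [cite: IEEE7542019, §6.3] -/
def fadd {φ₁ φ₂ : Format} (ψ : Format) (a : MiniFloat φ₁) (b : MiniFloat φ₂) : MiniFloat ψ :=
  if a.toRat + b.toRat = 0 then signedZero ψ (a.neg && b.neg) else roundNE ψ (a.toRat + b.toRat)

/-- `fmul` has the value of `roundNE` of the exact product. [folklore] -/
theorem toRat_fmul {φ₁ φ₂ : Format} (ψ : Format) (a : MiniFloat φ₁) (b : MiniFloat φ₂) :
    (fmul ψ a b).toRat = (roundNE ψ (a.toRat * b.toRat)).toRat := by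
  unfold fmul
  split
  · rename_i h; rw [h, toRat_signedZero, toRat_roundNE_zero]
  · rfl

/-- `fadd` has the value of `roundNE` of the exact sum. [folklore] -/
theorem toRat_fadd {φ₁ φ₂ : Format} (ψ : Format) (a : MiniFloat φ₁) (b : MiniFloat φ₂) :
    (fadd ψ a b).toRat = (roundNE ψ (a.toRat + b.toRat)).toRat := by
  unfold fadd
  split
  · rename_i h; rw [h, toRat_signedZero, toRat_roundNE_zero]
  · rfl

/-- One row of the exhaustive product table: operands, exact product, rounded datum, signed
error. [folklore] -/
def mulRow (φ : Format) (a b : MiniFloat φ) : MiniFloat φ × MiniFloat φ × ℚ × MiniFloat φ × ℚ :=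
  (a, b, a.toRat * b.toRat, fmul φ a b, errMul φ a b)

/-- One row of the exhaustive sum table. [folklore] -/
def addRow (φ : Format) (a b : MiniFloat φ) : MiniFloat φ × MiniFloat φ × ℚ × MiniFloat φ × ℚ :=
  (a, b, a.toRat + b.toRat, fadd φ a b, errAdd φ a b)

/-- The exhaustive product table of `φ` (all ordered pairs of finite data, `|all φ|²` rows).
[folklore] -/
def mulTable (φ : Format) : List (MiniFloat φ × MiniFloat φ × ℚ × MiniFloat φ × ℚ) :=
  (all φ).flatMap fun a => (all φ).map fun b => mulRow φ a b

/-- The exhaustive sum table of `φ`. [folklore] -/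
def addTable (φ : Format) : List (MiniFloat φ × MiniFloat φ × ℚ × MiniFloat φ × ℚ) :=
  (all φ).flatMap fun a => (all φ).map fun b => addRow φ a b

/-- Largest `|f a b|` over the ordered pairs satisfying the Boolean filter `P` (`0` if none):
the envelope functional of the tables. [folklore] -/
def maxAbsOver (φ : Format) (f : MiniFloat φ → MiniFloat φ → ℚ)
    (P : MiniFloat φ → MiniFloat φ → Bool) : ℚ :=
  (all φ).foldr (fun a acc => (all φ).foldr (fun b acc' => if P a b then max |f a b| acc' else acc')
    acc) 0

/-! ### Rounding smoke tests (kernel evaluation of `roundNE` on named formats) -/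

/-- `E2M1` rounding examples: `5/4 ↦ 1` (tie, even significand), `7/4 ↦ 2` (tie across a binade,
even), `11/4 ↦ 3`, `5 ↦ 4` (tie between `4` and `6`, even), `100 ↦ 6` and `-100 ↦ -6`
(saturation), `1/5 ↦ 0`, `-1/5 ↦ -0` (value `0`). [folklore] -/
theorem roundNE_E2M1_examples :
    (roundNE E2M1 (5 / 4)).toRat = 1 ∧ (roundNE E2M1 (7 / 4)).toRat = 2 ∧
    (roundNE E2M1 (11 / 4)).toRat = 3 ∧ (roundNE E2M1 5).toRat = 4 ∧
    (roundNE E2M1 100).toRat = 6 ∧ (roundNE E2M1 (-100)).toRat = -6 ∧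
    (roundNE E2M1 (1 / 5)).toRat = 0 ∧ (roundNE E2M1 (-1 / 5)).toRat = 0 ∧
    (roundNE E2M1 (-1 / 5)).neg = true := by decide +kernel

/-- `E4M3` rounding examples: `1/1000 ↦ 2^-9` (0.512 quanta), `449 ↦ 448`, `465 ↦ 448`
(saturation past the IEEE overflow threshold `464`), `17/16 ↦ 1` (tie, even) and `19/16 ↦ 5/4`
(tie, even). [folklore] -/
theorem roundNE_E4M3_examples :
    (roundNE E4M3 (1 / 1000)).toRat = 1 / 2 ^ 9 ∧ (roundNE E4M3 449).toRat = 448 ∧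
    (roundNE E4M3 465).toRat = 448 ∧ (roundNE E4M3 (17 / 16)).toRat = 1 ∧
    (roundNE E4M3 (19 / 16)).toRat = 5 / 4 := by decide +kernel

/-- OVERFLOW THRESHOLDS (pre-saturation RNE flag): `E4M3` (top significand `14`, even): `464 =
448 + ulp/2` does NOT overflow (tie to even `448`), `465` does; `E5M2` (top significand `7`, odd):
`61439` does not, `61440 = 57344 + ulp/2` DOES (tie to the even successor `2^16`, out of range);
`binary16`: `65519` no, `65520` yes. [cite: IEEE7542019, §4.3.1] -/
theorem overflowNE_examples :
    overflowNE E4M3 464 = false ∧ overflowNE E4M3 465 = true ∧ overflowNE E4M3 (-465) = true ∧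
    overflowNE E5M2 61439 = false ∧ overflowNE E5M2 61440 = true ∧
    overflowNE Binary16 65519 = false ∧ overflowNE Binary16 65520 = true := by
  decide +kernel

/-! ### Generic envelopes (instances of the standard model) -/

/-- PRODUCT, standard model: within range, `|fl(ab) - ab| ≤ max (u·|ab|) (quantum/2)`.
[cite: Higham2002ASNA, Thm 2.2] -/
theorem abs_errMul_le_max (a b : MiniFloat φ) (h : |a.toRat * b.toRat| ≤ φ.maxRat) :
    |errMul φ a b| ≤ max (φ.unitRoundoff * |a.toRat * b.toRat|) (φ.quantum / 2) := by
  unfold errMul; rw [abs_sub_comm]; exact abs_sub_roundNE_le_max h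

/-- SUM, standard model: within range, `|fl(a+b) - (a+b)| ≤ max (u·|a+b|) (quantum/2)`.
[cite: Higham2002ASNA, Thm 2.2] -/
theorem abs_errAdd_le_max (a b : MiniFloat φ) (h : |a.toRat + b.toRat| ≤ φ.maxRat) :
    |errAdd φ a b| ≤ max (φ.unitRoundoff * |a.toRat + b.toRat|) (φ.quantum / 2) := by
  unfold errAdd; rw [abs_sub_comm]; exact abs_sub_roundNE_le_max h

/-- PRODUCT, normal range: `2^m·quantum ≤ |ab| ≤ maxRat` gives `|fl(ab) - ab| ≤ u |ab|`.
[cite: Higham2002ASNA, Thm 2.2] -/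
theorem abs_errMul_le_unitRoundoff_mul (a b : MiniFloat φ)
    (hlo : 2 ^ φ.manBits * φ.quantum ≤ |a.toRat * b.toRat|) (hhi : |a.toRat * b.toRat| ≤ φ.maxRat) :
    |errMul φ a b| ≤ φ.unitRoundoff * |a.toRat * b.toRat| := by
  unfold errMul; rw [abs_sub_comm]; exact abs_sub_roundNE_le_unitRoundoff_mul hlo hhi

/-- SUM, normal range: `2^m·quantum ≤ |a+b| ≤ maxRat` gives `|fl(a+b) - (a+b)| ≤ u |a+b|`.
[cite: Higham2002ASNA, Thm 2.2] -/
theorem abs_errAdd_le_unitRoundoff_mul (a b : MiniFloat φ)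
    (hlo : 2 ^ φ.manBits * φ.quantum ≤ |a.toRat + b.toRat|) (hhi : |a.toRat + b.toRat| ≤ φ.maxRat) :
    |errAdd φ a b| ≤ φ.unitRoundoff * |a.toRat + b.toRat| := by
  unfold errAdd; rw [abs_sub_comm]; exact abs_sub_roundNE_le_unitRoundoff_mul hlo hhi

/-! ### Exactness of small sums (gradual underflow) -/

/-- A rational that is the value of some finite datum is rounded to itself. [folklore] -/
theorem toRat_roundNE_of_exists {t : ℚ} (h : ∃ y : MiniFloat φ, y.toRat = t) :
    (roundNE φ t).toRat = t := by
  obtain ⟨y, rfl⟩ := h; exact toRat_roundNE_toRat y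

/-- An integer multiple `N · quantum` with `|N| < 2^(m+1)` and `|N| ≤ maxScaled` is the value of a
finite datum (the unit-spacing region: subnormals and the first normal binade). [folklore] -/
theorem exists_toRat_eq_int_mul_quantum {N : ℤ} (hN : N.natAbs < 2 ^ (φ.manBits + 1))
    (hle : N.natAbs ≤ φ.maxScaled) : ∃ y : MiniFloat φ, y.toRat = (N : ℚ) * φ.quantum := by
  have hrep : φ.Representable N.natAbs := representable_of_lt_pow hN hle
  refine ⟨ofScaled φ (decide (N < 0)) _ hle, ?_⟩
  rw [toRat_ofScaled hle hrep]
  have hcast : ((N.natAbs : ℕ) : ℚ) = |(N : ℚ)| := by rw [Nat.cast_natAbs, Int.cast_abs]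
  by_cases hN0 : N < 0
  · have hN0' : (N : ℚ) < 0 := by exact_mod_cast hN0
    rw [if_pos (by simpa using hN0), hcast, abs_of_neg hN0']; ring
  · have hN0' : (0 : ℚ) ≤ N := by exact_mod_cast not_lt.mp hN0
    rw [if_neg (by simpa using hN0), hcast, abs_of_nonneg hN0']

/-- Sums of data are integer multiples of the quantum. [folklore] -/
theorem toRat_add_toRat (a b : MiniFloat φ) :
    a.toRat + b.toRat = ((a.toInt + b.toInt : ℤ) : ℚ) * φ.quantum := by
  unfold toRat; push_cast; ring

/-- With at least two normal binades the unit-spacing region is within range: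
`2^(m+1) ≤ maxScaled`. [folklore] -/
theorem _root_.Literature.ComputerArithmetic.FloatingPoint.Format.pow_le_maxScaled
    (h : 2 ≤ φ.emaxCode) : 2 ^ (φ.manBits + 1) ≤ φ.maxScaled := by
  unfold Format.maxScaled Format.scaled
  rw [if_neg (by omega), pow_succ]
  have : 2 ≤ 2 ^ (φ.emaxCode - 1) := by
    calc 2 = 2 ^ 1 := by norm_num
      _ ≤ 2 ^ (φ.emaxCode - 1) := Nat.pow_le_pow_right (by norm_num) (by omega)
  exact Nat.mul_le_mul (Nat.le_add_right _ _) this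

/-- EXACT SMALL SUMS: if `|a + b| < 2^(m+1) · quantum` (the region where the spacing of `φ` is one
quantum — all subnormals and the first normal binade) then `fl(a + b) = a + b`; in particular an
addition/subtraction whose result is subnormal is exact. Stated for formats with at least two
normal binades (`2 ≤ emaxCode`, true of every named format), which puts that region within range.
[cite: Higham2002ASNA, §2.6] -/
theorem errAdd_eq_zero_of_small (hφ : 2 ≤ φ.emaxCode) (a b : MiniFloat φ)
    (h : |a.toRat + b.toRat| < 2 ^ (φ.manBits + 1) * φ.quantum) : errAdd φ a b = 0 := by
  unfold errAdd
  rw [sub_eq_zero]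
  apply toRat_roundNE_of_exists
  have hq := φ.quantum_pos
  rw [toRat_add_toRat] at h ⊢
  set N : ℤ := a.toInt + b.toInt with hN
  have hcast : ((N.natAbs : ℕ) : ℚ) = |(N : ℚ)| := by rw [Nat.cast_natAbs, Int.cast_abs]
  have hNlt : N.natAbs < 2 ^ (φ.manBits + 1) := by
    rw [abs_mul, abs_of_pos hq] at h
    have : |(N : ℚ)| < 2 ^ (φ.manBits + 1) := lt_of_mul_lt_mul_right h hq.le
    rw [← hcast] at this
    exact_mod_cast this
  exact exists_toRat_eq_int_mul_quantum hNlt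
    (le_trans hNlt.le (Format.pow_le_maxScaled hφ))

end MiniFloat

end Literature.ComputerArithmetic.FloatingPoint
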